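import Summits.CriticalPhenomena.PercolationContinuityZ3.Theorems.PercNearOneGluingNoHeavyLowerTailFourPointJoinConvolution
import Summits.CriticalPhenomena.PercolationContinuityZ3.Theorems.PercNearOneGluingNoHeavyLowerTailQ44SeparatorTools
import Literature.Probability.LatticeModels.ProdBernoulliAtomExpansion
import HarnessLib

/-!
# Three-port splits of a weighted graph: the fifteen four-point cells as bilinear forms in the side of `a` and the port law

Support file for crux `stmt-CriticalPhenomena-4575` (master-family programme; Conjecture W = row `Q44` ∀n), seat `prim-l12-p6` gen 28;
memo `run/shared/lean/prim/prim-l12/FROM-prim-l12-p6-g27-PORT-TRANSFER.md` §1 (STRUCTURE LEMMA) and the gen-28 memo.  Sequel of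
`…FourPointJoinConvolution` (`FourPointPort.cell_eq_sum_join`).

A **three-port split** (`FourPointPort.IsPortSplit D₁ D₂ w w₁ w₂ a b c y`) of a weighting `w` on the pairs of `Fin n`: disjoint pair sets `D₁`
(the side of `a`) and `D₂` (the far side) meeting only in marked points, `w` vanishing off `D₁ ∪ D₂`, pieces `w₁ = w·1_{D₁}`, `w₂ = w·1_{D₂}`,
and `a` on no pair of `D₂`, `a ∉ {b,c,y}` — so the far side sees only the three PORTS `b, c, y`.  Then:
* `IsPortSplit.far_cells` — the ten far-side cells joining `a` to another marked point vanish, so the far side enters only through the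
  three-point law `q = cell w₂ 0` (`b|c|y`), `u_b = cell w₂ 1` (`b|cy`), `u_c = cell w₂ 2` (`c|by`), `u_y = cell w₂ 3` (`y|bc`), `x = cell w₂ 7` (`bcy`);
* `IsPortSplit.cell0_eq` … `IsPortSplit.cell14_eq` — **the three-port transfer**: each of the 15 cells of `w` as an explicit bilinear form
  in the 15 cells of `w₁` and `(q, u_b, u_c, u_y, x)` (e.g. `cell w 11 = cell w₁ 6 · u_b + cell w₁ 11 · (q + u_b)`: `ab|cy` arises from `ab|c|y`
  on the side of `a` with `c ~ y` beyond the ports, or from `ab|cy` on the side with `c, y` not separated further);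
* `IsPortSplit.of_side` — the split cut out by a vertex set `S ∋ a` avoiding `b, c, y` all of whose outgoing pairs of positive weight
  end at ports (`w₁` = restriction of `w` to the pairs meeting `S`, `w₂` = restriction to the pairs missing `S`).
One definition (`IsPortSplit`, a predicate with parameters — bookkeeping, not a statement), no named facts, no sorries, standard axioms.
Consumer: `…Q44PortGluing` (Conjecture W is stable under three-port gluing).
-/

noncomputable section

namespace Summit.CriticalPhenomena.PercolationContinuityZ3.Theorems

namespace FourPointPort

open MeasureTheory Set Literature.Probability.LatticeModels Literature.Probability.Percolation
open FourPointAtoms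
open Summit.CriticalPhenomena.PercolationContinuityZ3.Cruxes.AdditiveGluing.TieLine.ConnAtoms

variable {n : ℕ}

/-! ## The three-port case: the marked point `a` meets no far-side pair -/

/-- **Three-port split** of a weighting `w` with marked points `a b c y`: two disjoint pair sets `D₁` (the side of `a`) and `D₂` (the far
side) meeting only in marked points, `w` vanishing off `D₁ ∪ D₂`, the pieces `w₁ = w·1_{D₁}`, `w₂ = w·1_{D₂}`, and `a` on no pair of `D₂`
(so the far side sees only the three ports `b, c, y`), `a ∉ {b, c, y}`.  A predicate with parameters, not a statement. [this work] -/
structure IsPortSplit (D₁ D₂ : Finset (Sym2 (Fin n))) (w w₁ w₂ : Sym2 (Fin n) → unitInterval) (a b c y : Fin n) : Prop where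
  /-- the two pair sets are disjoint -/
  disjoint : Disjoint D₁ D₂
  /-- the two pieces meet only in marked points -/
  terminal : ∀ v : Fin n, ∀ e₁ ∈ D₁, ∀ e₂ ∈ D₂, v ∈ e₁ → v ∈ e₂ → v ∈ Set.range (quad a b c y)
  /-- `w` vanishes off `D₁ ∪ D₂` -/
  zero : ∀ e, e ∉ D₁ → e ∉ D₂ → w e = 0
  /-- `w₁ = w` on `D₁` -/
  left : ∀ e ∈ D₁, w e = w₁ e
  /-- `w₁ = 0` off `D₁` -/
  left_zero : ∀ e, e ∉ D₁ → w₁ e = 0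
  /-- `w₂ = w` on `D₂` -/
  right : ∀ e ∈ D₂, w e = w₂ e
  /-- `w₂ = 0` off `D₂` -/
  right_zero : ∀ e, e ∉ D₂ → w₂ e = 0
  /-- `a` lies on no far-side pair -/
  far : ∀ e ∈ D₂, a ∉ e
  /-- `a ≠ b` -/
  ne_b : a ≠ b
  /-- `a ≠ c` -/
  ne_c : a ≠ c
  /-- `a ≠ y` -/
  ne_y : a ≠ y

namespace IsPortSplit

variable {D₁ D₂ : Finset (Sym2 (Fin n))} {w w₁ w₂ : Sym2 (Fin n) → unitInterval} {a b c y : Fin n}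

/-- On the far side `a` is a.s. isolated: every far-side cell whose pattern joins `a` to the marked point `quad j` vanishes. [this work] -/
theorem far_cell_eq_zero (h : IsPortSplit D₁ D₂ w w₁ w₂ a b c y) (k : Fin 15) (j : Fin 4) (hx : a ≠ quad a b c y j)
    (hkj : pat4 k 0 = pat4 k j) : cell w₂ a b c y k = 0 :=
  ConjWPort.cell_eq_zero_of_absent w₂ a b c y k 0 j hx hkj fun u _ => by
    have hz : w₂ s(quad a b c y 0, u) = 0 := h.right_zero _ fun he => h.far _ he (Sym2.mem_mk_left _ u)
    rw [hz]; rfl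

/-- The ten far-side cells in which `a` is joined to another marked point vanish. [this work] -/
theorem far_cells (h : IsPortSplit D₁ D₂ w w₁ w₂ a b c y) :
    cell w₂ a b c y 4 = 0 ∧ cell w₂ a b c y 5 = 0 ∧ cell w₂ a b c y 6 = 0 ∧ cell w₂ a b c y 8 = 0 ∧ cell w₂ a b c y 9 = 0 ∧
      cell w₂ a b c y 10 = 0 ∧ cell w₂ a b c y 11 = 0 ∧ cell w₂ a b c y 12 = 0 ∧ cell w₂ a b c y 13 = 0 ∧ cell w₂ a b c y 14 = 0 :=
  ⟨h.far_cell_eq_zero 4 3 h.ne_y (by decide), h.far_cell_eq_zero 5 2 h.ne_c (by decide), h.far_cell_eq_zero 6 1 h.ne_b (by decide),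
    h.far_cell_eq_zero 8 3 h.ne_y (by decide), h.far_cell_eq_zero 9 2 h.ne_c (by decide), h.far_cell_eq_zero 10 2 h.ne_c (by decide),
    h.far_cell_eq_zero 11 1 h.ne_b (by decide), h.far_cell_eq_zero 12 1 h.ne_b (by decide), h.far_cell_eq_zero 13 1 h.ne_b (by decide),
    h.far_cell_eq_zero 14 1 h.ne_b (by decide)⟩

/-- **Three-port transfer, cell 0** (all separate): the cell of the glued weighting as a bilinear form in the cells of the `a`-side `w₁` and the
three-point law `(q, u_b, u_c, u_y, x) = (cell w₂ 0, cell w₂ 1, cell w₂ 2, cell w₂ 3, cell w₂ 7)` of the ports in the far side. [this work] -/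
theorem cell0_eq (h : IsPortSplit D₁ D₂ w w₁ w₂ a b c y) :
    cell w a b c y 0 = cell w₁ a b c y 0 * cell w₂ a b c y 0 := by
  obtain ⟨z4, z5, z6, z8, z9, z10, z11, z12, z13, z14⟩ := h.far_cells
  rw [cell_eq_sum_join h.disjoint h.terminal h.zero h.left h.left_zero h.right h.right_zero 0]
  simp [Fin.sum_univ_succ, joinIdx, z4, z5, z6, z8, z9, z10, z11, z12, z13, z14]
  try ring

/-- **Three-port transfer, cell 1** (`c ~ y` only): the cell of the glued weighting as a bilinear form in the cells of the `a`-side `w₁` and the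
three-point law `(q, u_b, u_c, u_y, x) = (cell w₂ 0, cell w₂ 1, cell w₂ 2, cell w₂ 3, cell w₂ 7)` of the ports in the far side. [this work] -/
theorem cell1_eq (h : IsPortSplit D₁ D₂ w w₁ w₂ a b c y) :
    cell w a b c y 1 = cell w₁ a b c y 0 * cell w₂ a b c y 1 + cell w₁ a b c y 1 * (cell w₂ a b c y 0 + cell w₂ a b c y 1) := by
  obtain ⟨z4, z5, z6, z8, z9, z10, z11, z12, z13, z14⟩ := h.far_cells
  rw [cell_eq_sum_join h.disjoint h.terminal h.zero h.left h.left_zero h.right h.right_zero 1]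
  simp [Fin.sum_univ_succ, joinIdx, z4, z5, z6, z8, z9, z10, z11, z12, z13, z14]
  try ring

/-- **Three-port transfer, cell 2** (`b ~ y` only): the cell of the glued weighting as a bilinear form in the cells of the `a`-side `w₁` and the
three-point law `(q, u_b, u_c, u_y, x) = (cell w₂ 0, cell w₂ 1, cell w₂ 2, cell w₂ 3, cell w₂ 7)` of the ports in the far side. [this work] -/
theorem cell2_eq (h : IsPortSplit D₁ D₂ w w₁ w₂ a b c y) :
    cell w a b c y 2 = cell w₁ a b c y 0 * cell w₂ a b c y 2 + cell w₁ a b c y 2 * (cell w₂ a b c y 0 + cell w₂ a b c y 2) := by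
  obtain ⟨z4, z5, z6, z8, z9, z10, z11, z12, z13, z14⟩ := h.far_cells
  rw [cell_eq_sum_join h.disjoint h.terminal h.zero h.left h.left_zero h.right h.right_zero 2]
  simp [Fin.sum_univ_succ, joinIdx, z4, z5, z6, z8, z9, z10, z11, z12, z13, z14]
  try ring

/-- **Three-port transfer, cell 3** (`b ~ c` only): the cell of the glued weighting as a bilinear form in the cells of the `a`-side `w₁` and the
three-point law `(q, u_b, u_c, u_y, x) = (cell w₂ 0, cell w₂ 1, cell w₂ 2, cell w₂ 3, cell w₂ 7)` of the ports in the far side. [this work] -/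
theorem cell3_eq (h : IsPortSplit D₁ D₂ w w₁ w₂ a b c y) :
    cell w a b c y 3 = cell w₁ a b c y 0 * cell w₂ a b c y 3 + cell w₁ a b c y 3 * (cell w₂ a b c y 0 + cell w₂ a b c y 3) := by
  obtain ⟨z4, z5, z6, z8, z9, z10, z11, z12, z13, z14⟩ := h.far_cells
  rw [cell_eq_sum_join h.disjoint h.terminal h.zero h.left h.left_zero h.right h.right_zero 3]
  simp [Fin.sum_univ_succ, joinIdx, z4, z5, z6, z8, z9, z10, z11, z12, z13, z14]
  try ring

/-- **Three-port transfer, cell 4** (`a ~ y` only): the cell of the glued weighting as a bilinear form in the cells of the `a`-side `w₁` and the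
three-point law `(q, u_b, u_c, u_y, x) = (cell w₂ 0, cell w₂ 1, cell w₂ 2, cell w₂ 3, cell w₂ 7)` of the ports in the far side. [this work] -/
theorem cell4_eq (h : IsPortSplit D₁ D₂ w w₁ w₂ a b c y) :
    cell w a b c y 4 = cell w₁ a b c y 4 * cell w₂ a b c y 0 := by
  obtain ⟨z4, z5, z6, z8, z9, z10, z11, z12, z13, z14⟩ := h.far_cells
  rw [cell_eq_sum_join h.disjoint h.terminal h.zero h.left h.left_zero h.right h.right_zero 4]
  simp [Fin.sum_univ_succ, joinIdx, z4, z5, z6, z8, z9, z10, z11, z12, z13, z14]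
  try ring

/-- **Three-port transfer, cell 5** (`a ~ c` only): the cell of the glued weighting as a bilinear form in the cells of the `a`-side `w₁` and the
three-point law `(q, u_b, u_c, u_y, x) = (cell w₂ 0, cell w₂ 1, cell w₂ 2, cell w₂ 3, cell w₂ 7)` of the ports in the far side. [this work] -/
theorem cell5_eq (h : IsPortSplit D₁ D₂ w w₁ w₂ a b c y) :
    cell w a b c y 5 = cell w₁ a b c y 5 * cell w₂ a b c y 0 := by
  obtain ⟨z4, z5, z6, z8, z9, z10, z11, z12, z13, z14⟩ := h.far_cells
  rw [cell_eq_sum_join h.disjoint h.terminal h.zero h.left h.left_zero h.right h.right_zero 5]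
  simp [Fin.sum_univ_succ, joinIdx, z4, z5, z6, z8, z9, z10, z11, z12, z13, z14]
  try ring

/-- **Three-port transfer, cell 6** (`a ~ b` only): the cell of the glued weighting as a bilinear form in the cells of the `a`-side `w₁` and the
three-point law `(q, u_b, u_c, u_y, x) = (cell w₂ 0, cell w₂ 1, cell w₂ 2, cell w₂ 3, cell w₂ 7)` of the ports in the far side. [this work] -/
theorem cell6_eq (h : IsPortSplit D₁ D₂ w w₁ w₂ a b c y) :
    cell w a b c y 6 = cell w₁ a b c y 6 * cell w₂ a b c y 0 := by
  obtain ⟨z4, z5, z6, z8, z9, z10, z11, z12, z13, z14⟩ := h.far_cells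
  rw [cell_eq_sum_join h.disjoint h.terminal h.zero h.left h.left_zero h.right h.right_zero 6]
  simp [Fin.sum_univ_succ, joinIdx, z4, z5, z6, z8, z9, z10, z11, z12, z13, z14]
  try ring

/-- **Three-port transfer, cell 7** (`a | bcy`): the cell of the glued weighting as a bilinear form in the cells of the `a`-side `w₁` and the
three-point law `(q, u_b, u_c, u_y, x) = (cell w₂ 0, cell w₂ 1, cell w₂ 2, cell w₂ 3, cell w₂ 7)` of the ports in the far side. [this work] -/
theorem cell7_eq (h : IsPortSplit D₁ D₂ w w₁ w₂ a b c y) :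
    cell w a b c y 7 = cell w₁ a b c y 0 * cell w₂ a b c y 7 + cell w₁ a b c y 1 * (cell w₂ a b c y 2 + cell w₂ a b c y 3 + cell w₂ a b c y 7) + cell w₁ a b c y 2 * (cell w₂ a b c y 1 + cell w₂ a b c y 3 + cell w₂ a b c y 7) + cell w₁ a b c y 3 * (cell w₂ a b c y 1 + cell w₂ a b c y 2 + cell w₂ a b c y 7) + cell w₁ a b c y 7 * (cell w₂ a b c y 0 + cell w₂ a b c y 1 + cell w₂ a b c y 2 + cell w₂ a b c y 3 + cell w₂ a b c y 7) := by
  obtain ⟨z4, z5, z6, z8, z9, z10, z11, z12, z13, z14⟩ := h.far_cells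
  rw [cell_eq_sum_join h.disjoint h.terminal h.zero h.left h.left_zero h.right h.right_zero 7]
  simp [Fin.sum_univ_succ, joinIdx, z4, z5, z6, z8, z9, z10, z11, z12, z13, z14]
  try ring

/-- **Three-port transfer, cell 8** (`ay | bc`): the cell of the glued weighting as a bilinear form in the cells of the `a`-side `w₁` and the
three-point law `(q, u_b, u_c, u_y, x) = (cell w₂ 0, cell w₂ 1, cell w₂ 2, cell w₂ 3, cell w₂ 7)` of the ports in the far side. [this work] -/
theorem cell8_eq (h : IsPortSplit D₁ D₂ w w₁ w₂ a b c y) :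
    cell w a b c y 8 = cell w₁ a b c y 4 * cell w₂ a b c y 3 + cell w₁ a b c y 8 * (cell w₂ a b c y 0 + cell w₂ a b c y 3) := by
  obtain ⟨z4, z5, z6, z8, z9, z10, z11, z12, z13, z14⟩ := h.far_cells
  rw [cell_eq_sum_join h.disjoint h.terminal h.zero h.left h.left_zero h.right h.right_zero 8]
  simp [Fin.sum_univ_succ, joinIdx, z4, z5, z6, z8, z9, z10, z11, z12, z13, z14]
  try ring

/-- **Three-port transfer, cell 9** (`ac | by`): the cell of the glued weighting as a bilinear form in the cells of the `a`-side `w₁` and the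
three-point law `(q, u_b, u_c, u_y, x) = (cell w₂ 0, cell w₂ 1, cell w₂ 2, cell w₂ 3, cell w₂ 7)` of the ports in the far side. [this work] -/
theorem cell9_eq (h : IsPortSplit D₁ D₂ w w₁ w₂ a b c y) :
    cell w a b c y 9 = cell w₁ a b c y 5 * cell w₂ a b c y 2 + cell w₁ a b c y 9 * (cell w₂ a b c y 0 + cell w₂ a b c y 2) := by
  obtain ⟨z4, z5, z6, z8, z9, z10, z11, z12, z13, z14⟩ := h.far_cells
  rw [cell_eq_sum_join h.disjoint h.terminal h.zero h.left h.left_zero h.right h.right_zero 9]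
  simp [Fin.sum_univ_succ, joinIdx, z4, z5, z6, z8, z9, z10, z11, z12, z13, z14]
  try ring

/-- **Three-port transfer, cell 10** (`acy | b`): the cell of the glued weighting as a bilinear form in the cells of the `a`-side `w₁` and the
three-point law `(q, u_b, u_c, u_y, x) = (cell w₂ 0, cell w₂ 1, cell w₂ 2, cell w₂ 3, cell w₂ 7)` of the ports in the far side. [this work] -/
theorem cell10_eq (h : IsPortSplit D₁ D₂ w w₁ w₂ a b c y) :
    cell w a b c y 10 = cell w₁ a b c y 4 * cell w₂ a b c y 1 + cell w₁ a b c y 5 * cell w₂ a b c y 1 + cell w₁ a b c y 10 * (cell w₂ a b c y 0 + cell w₂ a b c y 1) := by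
  obtain ⟨z4, z5, z6, z8, z9, z10, z11, z12, z13, z14⟩ := h.far_cells
  rw [cell_eq_sum_join h.disjoint h.terminal h.zero h.left h.left_zero h.right h.right_zero 10]
  simp [Fin.sum_univ_succ, joinIdx, z4, z5, z6, z8, z9, z10, z11, z12, z13, z14]
  try ring

/-- **Three-port transfer, cell 11** (`ab | cy`): the cell of the glued weighting as a bilinear form in the cells of the `a`-side `w₁` and the
three-point law `(q, u_b, u_c, u_y, x) = (cell w₂ 0, cell w₂ 1, cell w₂ 2, cell w₂ 3, cell w₂ 7)` of the ports in the far side. [this work] -/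
theorem cell11_eq (h : IsPortSplit D₁ D₂ w w₁ w₂ a b c y) :
    cell w a b c y 11 = cell w₁ a b c y 6 * cell w₂ a b c y 1 + cell w₁ a b c y 11 * (cell w₂ a b c y 0 + cell w₂ a b c y 1) := by
  obtain ⟨z4, z5, z6, z8, z9, z10, z11, z12, z13, z14⟩ := h.far_cells
  rw [cell_eq_sum_join h.disjoint h.terminal h.zero h.left h.left_zero h.right h.right_zero 11]
  simp [Fin.sum_univ_succ, joinIdx, z4, z5, z6, z8, z9, z10, z11, z12, z13, z14]
  try ring

/-- **Three-port transfer, cell 12** (`aby | c`): the cell of the glued weighting as a bilinear form in the cells of the `a`-side `w₁` and the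
three-point law `(q, u_b, u_c, u_y, x) = (cell w₂ 0, cell w₂ 1, cell w₂ 2, cell w₂ 3, cell w₂ 7)` of the ports in the far side. [this work] -/
theorem cell12_eq (h : IsPortSplit D₁ D₂ w w₁ w₂ a b c y) :
    cell w a b c y 12 = cell w₁ a b c y 4 * cell w₂ a b c y 2 + cell w₁ a b c y 6 * cell w₂ a b c y 2 + cell w₁ a b c y 12 * (cell w₂ a b c y 0 + cell w₂ a b c y 2) := by
  obtain ⟨z4, z5, z6, z8, z9, z10, z11, z12, z13, z14⟩ := h.far_cells
  rw [cell_eq_sum_join h.disjoint h.terminal h.zero h.left h.left_zero h.right h.right_zero 12]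
  simp [Fin.sum_univ_succ, joinIdx, z4, z5, z6, z8, z9, z10, z11, z12, z13, z14]
  try ring

/-- **Three-port transfer, cell 13** (`abc | y`): the cell of the glued weighting as a bilinear form in the cells of the `a`-side `w₁` and the
three-point law `(q, u_b, u_c, u_y, x) = (cell w₂ 0, cell w₂ 1, cell w₂ 2, cell w₂ 3, cell w₂ 7)` of the ports in the far side. [this work] -/
theorem cell13_eq (h : IsPortSplit D₁ D₂ w w₁ w₂ a b c y) :
    cell w a b c y 13 = cell w₁ a b c y 5 * cell w₂ a b c y 3 + cell w₁ a b c y 6 * cell w₂ a b c y 3 + cell w₁ a b c y 13 * (cell w₂ a b c y 0 + cell w₂ a b c y 3) := by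
  obtain ⟨z4, z5, z6, z8, z9, z10, z11, z12, z13, z14⟩ := h.far_cells
  rw [cell_eq_sum_join h.disjoint h.terminal h.zero h.left h.left_zero h.right h.right_zero 13]
  simp [Fin.sum_univ_succ, joinIdx, z4, z5, z6, z8, z9, z10, z11, z12, z13, z14]
  try ring

/-- **Three-port transfer, cell 14** (all joined): the cell of the glued weighting as a bilinear form in the cells of the `a`-side `w₁` and the
three-point law `(q, u_b, u_c, u_y, x) = (cell w₂ 0, cell w₂ 1, cell w₂ 2, cell w₂ 3, cell w₂ 7)` of the ports in the far side. [this work] -/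
theorem cell14_eq (h : IsPortSplit D₁ D₂ w w₁ w₂ a b c y) :
    cell w a b c y 14 = cell w₁ a b c y 4 * cell w₂ a b c y 7 + cell w₁ a b c y 5 * cell w₂ a b c y 7 + cell w₁ a b c y 6 * cell w₂ a b c y 7 + cell w₁ a b c y 8 * (cell w₂ a b c y 1 + cell w₂ a b c y 2 + cell w₂ a b c y 7) + cell w₁ a b c y 9 * (cell w₂ a b c y 1 + cell w₂ a b c y 3 + cell w₂ a b c y 7) + cell w₁ a b c y 10 * (cell w₂ a b c y 2 + cell w₂ a b c y 3 + cell w₂ a b c y 7) + cell w₁ a b c y 11 * (cell w₂ a b c y 2 + cell w₂ a b c y 3 + cell w₂ a b c y 7) + cell w₁ a b c y 12 * (cell w₂ a b c y 1 + cell w₂ a b c y 3 + cell w₂ a b c y 7) + cell w₁ a b c y 13 * (cell w₂ a b c y 1 + cell w₂ a b c y 2 + cell w₂ a b c y 7) + cell w₁ a b c y 14 * (cell w₂ a b c y 0 + cell w₂ a b c y 1 + cell w₂ a b c y 2 + cell w₂ a b c y 3 + cell w₂ a b c y 7) := by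
  obtain ⟨z4, z5, z6, z8, z9, z10, z11, z12, z13, z14⟩ := h.far_cells
  rw [cell_eq_sum_join h.disjoint h.terminal h.zero h.left h.left_zero h.right h.right_zero 14]
  simp [Fin.sum_univ_succ, joinIdx, z4, z5, z6, z8, z9, z10, z11, z12, z13, z14]
  try ring

/-- **The three-port split cut out by a vertex set.**  If `S ∋ a` avoids `b, c, y` and every pair of positive weight leaving `S` ends at one
of the ports `b, c, y`, then `w` splits along the ports into its restriction `w₁` to the pairs meeting `S` (the side of `a`) and its
restriction `w₂` to the pairs missing `S` (the far side). [this work] -/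
theorem of_side (w : Sym2 (Fin n) → unitInterval) (a b c y : Fin n) (S : Finset (Fin n)) (haS : a ∈ S) (hbS : b ∉ S) (hcS : c ∉ S)
    (hyS : y ∉ S) (hS : ∀ u ∈ S, ∀ v, v ∉ S → v ≠ b → v ≠ c → v ≠ y → w s(u, v) = 0) (w₁ w₂ : Sym2 (Fin n) → unitInterval)
    (hw₁ : ∀ e, w₁ e = if (∃ u ∈ S, u ∈ e) then w e else 0) (hw₂ : ∀ e, w₂ e = if (∃ u ∈ S, u ∈ e) then 0 else w e) :
    IsPortSplit (Finset.univ.filter fun e => (∃ u ∈ S, u ∈ e) ∧ w e ≠ 0) (Finset.univ.filter fun e => ∀ u ∈ S, u ∉ e)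
      w w₁ w₂ a b c y where
  disjoint := by
    rw [Finset.disjoint_left]
    intro e h1 h2
    rw [Finset.mem_filter] at h1 h2
    obtain ⟨u, huS, hue⟩ := h1.2.1
    exact h2.2 u huS hue
  terminal := by
    intro v e₁ he₁ e₂ he₂ hv₁ hv₂
    rw [Finset.mem_filter] at he₁ he₂
    obtain ⟨⟨u, huS, hue⟩, hwe⟩ := he₁.2
    have hvS : v ∉ S := fun h => he₂.2 v h hv₂
    have huv : u ≠ v := fun h => hvS (h ▸ huS)
    have he : e₁ = s(u, v) := by
      induction e₁ using Sym2.ind with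
      | _ p q =>
        rcases Sym2.mem_iff.1 hue with rfl | rfl <;> rcases Sym2.mem_iff.1 hv₁ with h | h
        · exact absurd h.symm huv
        · rw [h]
        · rw [h]; exact Sym2.eq_swap
        · exact absurd h.symm huv
    rw [he] at hwe
    by_cases hvb : v = b
    · exact ⟨1, hvb ▸ rfl⟩
    by_cases hvc : v = c
    · exact ⟨2, hvc ▸ rfl⟩
    by_cases hvy : v = y
    · exact ⟨3, hvy ▸ rfl⟩
    exact absurd (hS u huS v hvS hvb hvc hvy) hwe
  zero := by
    intro e h1 h2
    rw [Finset.mem_filter, not_and_or] at h1 h2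
    rcases h2 with h2 | h2
    · exact absurd (Finset.mem_univ e) h2
    rcases h1 with h1 | h1
    · exact absurd (Finset.mem_univ e) h1
    push Not at h1 h2
    obtain ⟨u, huS, hue⟩ := h2
    exact h1 ⟨u, huS, hue⟩
  left := by
    intro e he
    rw [Finset.mem_filter] at he
    rw [hw₁, if_pos he.2.1]
  left_zero := by
    intro e he
    rw [Finset.mem_filter, not_and_or] at he
    rw [hw₁]
    split_ifs with hex
    · rcases he with he | he
      · exact absurd (Finset.mem_univ e) he
      · by_contra hne
        exact he ⟨hex, hne⟩
    · rfl
  right := by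
    intro e he
    rw [Finset.mem_filter] at he
    rw [hw₂, if_neg (by push Not; exact he.2)]
  right_zero := by
    intro e he
    rw [Finset.mem_filter, not_and_or] at he
    rw [hw₂]
    split_ifs with hex
    · rfl
    · rcases he with he | he
      · exact absurd (Finset.mem_univ e) he
      · push Not at he hex
        obtain ⟨u, huS, hue⟩ := he
        exact absurd hue (hex u huS)
  far := by
    intro e he
    rw [Finset.mem_filter] at he
    exact he.2 a haS
  ne_b := fun h => hbS (h ▸ haS)
  ne_c := fun h => hcS (h ▸ haS)
  ne_y := fun h => hyS (h ▸ haS)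

end IsPortSplit

end FourPointPort

end Summit.CriticalPhenomena.PercolationContinuityZ3.Theorems
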